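import Literature.AlgebraicGeometry.HodgeTheory.BettiUniverseCupChainMatchings

/-!
# Cup chains with free slots: re-summation of a cyclic matching insertion (route `CyclicUnitaryPowers`, K2-A stub A)

Helper for the registered stub `stub_matchingClassesAlgebraicCyclic` (statement `MatchingClassesAlgebraicCyclic`) of the
crux `PowersHodgeOfDeckCommutators` (stmt-HodgeConjecture-19545, K2-A line `unitary-kunneth-fft` v6, skeleton
`e821e1634d2d5d3d`) of `route-HodgeConjecture-CyclicUnitaryPowers`; landed `--supports stmt-HodgeConjecture-19545`.
Sorry-free, no new definition, no named fact.

The Literature brick `BettiUniverse.ofRatClass_sum_smul_cupChain_mem_algebraicClasses`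
(`HodgeTheory/BettiUniverseCupChainMatchings`, written for the sign route's stub A) re-sums the Künneth insertion of
a matching tensor along a PERFECT pairing `e : Fin r ≃ Fin 2 × Fin j` of the slots.  The CYCLIC matching tensors of
route A have, in addition, FREE SLOTS: `ε : Fin r ≃ (Fin 2 × Fin j) ⊕ Fin l`, the free slot `a` carrying the
coordinates `c a : ι → ℚ` of a fixed class `z a = Σᵢ c a i · bᵢ` (a `σ`-invariant class of `H²(X; ℚ)`), so the
coefficient of the chain `x(w)` is `(∏ₘ Θₘ[w(ε⁻¹(0,m)), w(ε⁻¹(1,m))]) · ∏ₐ c a (w(ε⁻¹ a))`.  This file reduces the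
free-slot case to the brick:

* §1 `foldl_cupList_sum_smul_init` — a cup chain is linear in its initial class (stated against test classes
  `g t` of a common degree, so that it is a sigma equation);
* §2 `foldl_cupList_sum_prod_smul_prefix` — summing the first `l` slots of a chain against product coefficients
  `∏ₐ c a (φ a)` replaces the slot classes `y a i` by `Σᵢ c a i · y a i` (multilinearity, induction on `l` peeling
  the first slot, §1);
* §3 `exists_wdec_foldl_pull` — a chain `wdec ∪ f₀^* z₀ ∪ ⋯ ∪ f_{l−1}^* z_{l−1}` of pull-backs of classes with
  algebraic complexification is `⟨2Q, wdec'⟩` with `wdec'` algebraic (cup products and pull-backs preserve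
  algebraic classes, granted Fulton's pull-back fact);
* §4 **`ofRatClass_sum_smul_cupChain_free_mem_algebraicClasses`** — the free-slot re-summation: sort the slots
  "free slots first, then the pairs" (a global sign, `foldl_cupList_ofFn_perm`), absorb the free slots into the
  decoration by §2–§3, and apply the brick to the remaining perfect pairing.

All classes have even degree `2n'` (the route: `n' = 1`, `H²` of a surface).

## References

* C. Voisin, *Hodge Theory and Complex Algebraic Geometry II* (2003), proof of Prop. 9.20, Prop. 9.21 (i)
  (cup products and pull-backs of algebraic classes). [VoisinHodgeII2003]
* W. Fulton, *Intersection Theory* (1998), §19.2 Cor. 19.2 (b). [Fulton1998]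
* A. Hatcher, *Algebraic Topology* (2002), §3.2 Prop. 3.10, Thm. 3.11. [HatcherAT2002]
-/

-- `Summit.HodgeConjecture.HodgeConjecture.Theorems` is the mandated namespace (single-problem summit), which
-- `linter.dupNamespace` flags; the lakefile turns the linter off tree-wide, restated here for stand-alone checks.
set_option linter.dupNamespace false

noncomputable section

open Literature.AlgebraicGeometry.Motives
open Literature.AlgebraicTopology.SingularHomology
open CategoryTheory CategoryTheory.Limits
open Literature.AlgebraicGeometry.HodgeTheory Literature.AlgebraicGeometry.HodgeTheory.BettiUniverse

namespace Summit.HodgeConjecture.HodgeConjecture.Theorems.CyclicUnitaryPowersCupChainFreeSlots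

variable {X Y : SchemeOver ℂ} {n : ℕ}

/-! ## §1 A cup chain is linear in its initial class -/

/-- **Linearity of a cup chain in its initial class** (sigma form, tested against classes `g t` of a
common degree `M`): if the chain of `L` started from `⟨d, v t⟩` is `⟨M, g t⟩` for every `t`, then the chain
started from `⟨d, Σₜ aₜ • vₜ⟩` is `⟨M, Σₜ aₜ • gₜ⟩` (bilinearity of the cup product, induction on `L`).
[cite: HatcherAT2002, §3.2 Prop. 3.10 (bilinearity of cup product)] -/
theorem foldl_cupList_sum_smul_init (L : List (bettiCohomology Y n)) (d : ℕ) {T : Type*} [Fintype T]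
    (a : T → ℚ) (v : T → bettiCohomology Y d) {M : ℕ} (g : T → bettiCohomology Y M)
    (hM : M = d + n * L.length)
    (hg : ∀ t, List.foldl (fun (acc : Σ i, bettiCohomology Y i) (y : bettiCohomology Y n) =>
        ⟨acc.1 + n, cup Y acc.1 n acc.2 y⟩) ⟨d, v t⟩ L = ⟨M, g t⟩) :
    List.foldl (fun (acc : Σ i, bettiCohomology Y i) (y : bettiCohomology Y n) =>
        ⟨acc.1 + n, cup Y acc.1 n acc.2 y⟩) ⟨d, ∑ t, a t • v t⟩ L = ⟨M, ∑ t, a t • g t⟩ := by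
  induction L generalizing d with
  | nil =>
    rw [List.foldl_nil]
    simp only [List.foldl_nil] at hg
    rw [List.length_nil, mul_zero, add_zero] at hM
    exact sigma_mk_sum_smul_eq v g a hM.symm hg
  | cons y L ih =>
    rw [List.foldl_cons]
    have hg' : ∀ t, List.foldl (fun (acc : Σ i, bettiCohomology Y i) (y : bettiCohomology Y n) =>
        ⟨acc.1 + n, cup Y acc.1 n acc.2 y⟩) ⟨d + n, cup Y d n (v t) y⟩ L = ⟨M, g t⟩ := fun t ↦ by
      have h := hg t
      rwa [List.foldl_cons] at h
    have h : (⟨d + n, cup Y d n (∑ t, a t • v t) y⟩ : Σ i, bettiCohomology Y i) =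
        ⟨d + n, ∑ t, a t • cup Y d n (v t) y⟩ := by
      rw [LinearMap.map_sum₂]
      simp only [LinearMap.map_smul₂]
    dsimp only
    rw [h]
    exact ih (d + n) (fun t ↦ cup Y d n (v t) y) (by rw [hM, List.length_cons]; ring) hg'

/-! ## §2 Summing a prefix of slots against product coefficients -/

/-- **Prefix multilinearity of a cup chain.** Let `x(φ)`, `φ : Fin l → ι`, be the chain started from
`init` over the classes `y a (φ a)` (`a < l`) followed by a fixed `tail`. Then
`Σ_φ (∏ₐ c a (φ a)) • x(φ)` is the chain over the classes `Σᵢ c a i • y a i` followed by `tail`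
(induction on `l`, peeling the first slot into the initial class; §1). [cite: HatcherAT2002, §3.2 Prop. 3.10] -/
theorem foldl_cupList_sum_prod_smul_prefix {ι : Type*} [Fintype ι] [DecidableEq ι]
    (tail : List (bettiCohomology Y n)) :
    ∀ (l : ℕ) (init : Σ i, bettiCohomology Y i) (y : Fin l → ι → bettiCohomology Y n) (c : Fin l → ι → ℚ)
      {M : ℕ} (x : (Fin l → ι) → bettiCohomology Y M) (_hM : M = init.1 + n * l + n * tail.length)
      (_hx : ∀ φ, (⟨M, x φ⟩ : Σ i, bettiCohomology Y i) =
        List.foldl (fun (acc : Σ i, bettiCohomology Y i) (y : bettiCohomology Y n) =>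
            ⟨acc.1 + n, cup Y acc.1 n acc.2 y⟩) init (List.ofFn (fun a ↦ y a (φ a)) ++ tail)),
      (⟨M, ∑ φ : Fin l → ι, (∏ a, c a (φ a)) • x φ⟩ : Σ i, bettiCohomology Y i) =
        List.foldl (fun (acc : Σ i, bettiCohomology Y i) (y : bettiCohomology Y n) =>
            ⟨acc.1 + n, cup Y acc.1 n acc.2 y⟩) init (List.ofFn (fun a ↦ ∑ i, c a i • y a i) ++ tail) := by
  intro l
  induction l with
  | zero =>
    intro init y c M x hM hx
    rw [Fintype.sum_unique, Finset.univ_eq_empty, Finset.prod_empty, one_smul, hx, List.ofFn_zero,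
      List.ofFn_zero]
  | succ l ih =>
    intro init y c M x hM hx
    -- re-index the assignments by their first value
    have hsum : ∑ φ : Fin (l + 1) → ι, (∏ a, c a (φ a)) • x φ =
        ∑ i : ι, c 0 i • ∑ φ' : Fin l → ι, (∏ a, c a.succ (φ' a)) • x (Fin.cons i φ') := by
      rw [← (Fin.consEquiv fun _ : Fin (l + 1) ↦ ι).sum_comp, Fintype.sum_prod_type]
      refine Finset.sum_congr rfl fun i _ ↦ ?_
      rw [Finset.smul_sum]
      refine Finset.sum_congr rfl fun φ' _ ↦ ?_
      have hce : (Fin.consEquiv fun _ : Fin (l + 1) ↦ ι) (i, φ') = Fin.cons i φ' := rfl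
      rw [hce, Fin.prod_univ_succ, ← smul_smul]
      simp only [Fin.cons_zero, Fin.cons_succ]
    -- the inner sums, by induction, are chains from `init ∪ y 0 i`
    have hinner : ∀ i : ι, (⟨M, ∑ φ' : Fin l → ι, (∏ a, c a.succ (φ' a)) • x (Fin.cons i φ')⟩ :
        Σ i, bettiCohomology Y i) =
        List.foldl (fun (acc : Σ i, bettiCohomology Y i) (y : bettiCohomology Y n) =>
            ⟨acc.1 + n, cup Y acc.1 n acc.2 y⟩) ⟨init.1 + n, cup Y init.1 n init.2 (y 0 i)⟩
          (List.ofFn (fun a ↦ ∑ i', c a.succ i' • y a.succ i') ++ tail) := by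
      intro i
      refine ih ⟨init.1 + n, cup Y init.1 n init.2 (y 0 i)⟩ (fun a ↦ y a.succ) (fun a ↦ c a.succ)
        (fun φ' ↦ x (Fin.cons i φ')) (by rw [hM]; ring) (fun φ' ↦ ?_)
      rw [hx (Fin.cons i φ'), List.ofFn_succ, List.cons_append, List.foldl_cons]
      simp only [Fin.cons_zero, Fin.cons_succ]
    -- the outer sum, by §1
    have hout := foldl_cupList_sum_smul_init (List.ofFn (fun a ↦ ∑ i', c a.succ i' • y a.succ i') ++ tail)
      (init.1 + n) (c 0) (fun i ↦ cup Y init.1 n init.2 (y 0 i))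
      (fun i ↦ ∑ φ' : Fin l → ι, (∏ a, c a.succ (φ' a)) • x (Fin.cons i φ'))
      (by rw [List.length_append, List.length_ofFn, hM]; ring) fun i ↦ (hinner i).symm
    rw [hsum, ← hout, List.ofFn_succ, List.cons_append, List.foldl_cons]
    simp only [map_sum, map_smul]

/-! ## §3 Absorbing pull-backs of algebraic classes into the decoration -/

/-- **A chain of pull-backs of algebraic classes is an algebraic decoration**: for `f a : Y ⟶ X` and
classes `z a ∈ H^{2n'}(X; ℚ)` with algebraic complexification, the chain
`wdec ∪ f₀^* z₀ ∪ ⋯ ∪ f_{l−1}^* z_{l−1}` is `⟨2Q, wdec'⟩`, `Q = q + n' l`, with `wdec'` of algebraic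
complexification (cup products and pull-backs of algebraic classes are algebraic, granted Fulton's
pull-back fact `hP`). [cite: VoisinHodgeII2003, proof of Prop. 9.20 and Prop. 9.21 (i)]
[cite: Fulton1998, §19.2 Cor. 19.2 (b)] -/
theorem exists_wdec_foldl_pull (hP : fulton1998_map_mem_algebraicClasses) {lX lY : ℕ}
    (hX : IsSmoothProjective lX X) (hY : IsSmoothProjective lY Y) (n' : ℕ) :
    ∀ (l : ℕ) (f : Fin l → (Y ⟶ X)) (z : Fin l → bettiCohomology X (2 * n'))
      (_hz : ∀ a, ofRatClass (ComplexPoints X) (2 * n') (z a) ∈ algebraicClasses X n')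
      (q : ℕ) (wdec : bettiCohomology Y (2 * q))
      (_hwdec : ofRatClass (ComplexPoints Y) (2 * q) wdec ∈ algebraicClasses Y q) (Q : ℕ) (_hQ : Q = q + n' * l),
      ∃ wdec' : bettiCohomology Y (2 * Q),
        ofRatClass (ComplexPoints Y) (2 * Q) wdec' ∈ algebraicClasses Y Q ∧
        List.foldl (fun (acc : Σ i, bettiCohomology Y i) (y : bettiCohomology Y (2 * n')) =>
            ⟨acc.1 + 2 * n', cup Y acc.1 (2 * n') acc.2 y⟩) ⟨2 * q, wdec⟩
          (List.ofFn fun a ↦ pull (f a) (2 * n') (z a)) = ⟨2 * Q, wdec'⟩ := by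
  intro l
  induction l with
  | zero =>
    intro f z hz q wdec hwdec Q hQ
    rw [mul_zero, add_zero] at hQ
    subst hQ
    exact ⟨wdec, hwdec, by rw [List.ofFn_zero, List.foldl_nil]⟩
  | succ l ih =>
    intro f z hz q wdec hwdec Q hQ
    have hq : 2 * q + 2 * n' = 2 * (q + n') := by ring
    have hz0 : ofRatClass (ComplexPoints Y) (2 * n') (pull (f 0) (2 * n') (z 0)) ∈ algebraicClasses Y n' :=
      ofRatClass_pull_mem_algebraicClasses hP hX hY (f 0) (hz 0)
    have hw1 := ofRatClass_bettiCup_mem_algebraicClasses hP hY hq hwdec hz0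
    obtain ⟨wdec', hwdec', hfold⟩ := ih (fun a ↦ f a.succ) (fun a ↦ z a.succ) (fun a ↦ hz a.succ) (q + n')
      (bettiCup hq wdec (pull (f 0) (2 * n') (z 0))) hw1 Q (by rw [hQ]; ring)
    refine ⟨wdec', hwdec', ?_⟩
    rw [List.ofFn_succ, List.foldl_cons, ← hfold]
    congr 1
    exact sigma_mk_bettiCup_eq _ _ _ _

/-! ## §4 The insertion of a matching tensor with free slots is algebraic -/

/-- **Re-summation of a matching insertion with free slots.** Let `x(w) ∈ H^{2p}(Y; ℚ)`, `w : Fin r → ι`,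
be the classes `wdec ∪ π_{u 0}^* b_{w 0} ∪ ⋯ ∪ π_{u (r−1)}^* b_{w (r−1)}` (left-nested, a sigma equation — the
routes' Künneth normal form; all classes of even degree `2n'`), `ε : Fin r ≃ (Fin 2 × Fin j) ⊕ Fin l` a
pairing of `2j` of the slots leaving `l` free slots, `Θₘ` matrices whose two-slot insertions
`Σ Θₘ[i,i'] f^*bᵢ ∪ g^*b_{i'}` have algebraic complexification for all `f, g : Y ⟶ X`, and `c a : ι → ℚ`
(`a < l`) coordinates of classes `z a = Σᵢ c a i · bᵢ` of `X` with algebraic complexification.  Then the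
contraction `Σ_w (∏ₘ Θₘ[w(ε⁻¹(0,m)), w(ε⁻¹(1,m))]) (∏ₐ c a (w(ε⁻¹ a))) · x(w)` has algebraic
complexification: sorting the slots (free slots first, then pair by pair) costs a global sign
(`foldl_cupList_ofFn_perm`), the free slots are summed into the decoration
`wdec' = wdec ∪ π^* z₀ ∪ ⋯ ∪ π^* z_{l−1}` (§2, §3), and the perfect-pairing brick
`BettiUniverse.ofRatClass_sum_smul_cupChain_mem_algebraicClasses` finishes.
[cite: VoisinHodgeII2003, proof of Prop. 9.20 and Prop. 9.21 (i)] [cite: Fulton1998, §19.2 Cor. 19.2 (b)]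
[cite: HatcherAT2002, §3.2 Thm. 3.11] -/
theorem ofRatClass_sum_smul_cupChain_free_mem_algebraicClasses (hP : fulton1998_map_mem_algebraicClasses)
    {lX lY : ℕ} (hX : IsSmoothProjective lX X) (hY : IsSmoothProjective lY Y) (n' : ℕ)
    (h2 : 2 * n' + 2 * n' = 2 * (2 * n')) {ι : Type*} [Fintype ι] [DecidableEq ι]
    (bX : ι → bettiCohomology X (2 * n')) {m : ℕ} (π : Fin (m + 1) → (Y ⟶ X)) {r : ℕ} (u : Fin r → Fin (m + 1))
    (q : ℕ) (wdec : bettiCohomology Y (2 * q))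
    (hwdec : ofRatClass (ComplexPoints Y) (2 * q) wdec ∈ algebraicClasses Y q)
    (p : ℕ) (x : (Fin r → ι) → bettiCohomology Y (2 * p))
    (hx : ∀ w, (⟨2 * p, x w⟩ : Σ i, bettiCohomology Y i) =
      List.foldl (fun (acc : Σ i, bettiCohomology Y i) (i : Fin r) =>
          ⟨acc.1 + 2 * n', cup Y acc.1 (2 * n') acc.2 (pull (π (u i)) (2 * n') (bX (w i)))⟩)
        ⟨2 * q, wdec⟩ (List.finRange r))
    {j l : ℕ} (e : Fin r ≃ (Fin 2 × Fin j) ⊕ Fin l) (Θ : Fin j → ι → ι → ℚ)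
    (hΘ : ∀ (mm : Fin j) (f g : Y ⟶ X), ofRatClass (ComplexPoints Y) (2 * (2 * n'))
      (∑ i, ∑ i', Θ mm i i' • bettiCup h2 (pull f (2 * n') (bX i)) (pull g (2 * n') (bX i'))) ∈
        algebraicClasses Y (2 * n'))
    (c : Fin l → ι → ℚ)
    (hc : ∀ a, ofRatClass (ComplexPoints X) (2 * n') (∑ i, c a i • bX i) ∈ algebraicClasses X n') :
    ofRatClass (ComplexPoints Y) (2 * p)
      (∑ w : Fin r → ι, ((∏ mm, Θ mm (w (e.symm (Sum.inl (0, mm)))) (w (e.symm (Sum.inl (1, mm))))) *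
          ∏ a, c a (w (e.symm (Sum.inr a)))) • x w) ∈ algebraicClasses Y p := by
  classical
  -- `r = l + 2j`
  have hr : r = l + j * 2 := by
    have hcard := Fintype.card_congr e
    simp only [Fintype.card_fin, Fintype.card_sum, Fintype.card_prod] at hcard
    omega
  subst hr
  -- the empty case
  rcases isEmpty_or_nonempty (Fin (l + j * 2) → ι) with hE | ⟨⟨w₀⟩⟩
  · rw [Fintype.sum_empty, map_zero]
    exact Submodule.zero_mem _
  -- the sorting permutation: free slots first, then the pairs, pair by pair
  set s : Equiv.Perm (Fin (l + j * 2)) := finSumFinEquiv.symm.trans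
    ((Equiv.sumCongr (Equiv.refl (Fin l)) (finProdFinEquiv.symm.trans (Equiv.prodComm (Fin j) (Fin 2)))).trans
      ((Equiv.sumComm (Fin l) (Fin 2 × Fin j)).trans e.symm)) with hsdef
  have hsA : ∀ a : Fin l, s (Fin.castAdd (j * 2) a) = e.symm (Sum.inr a) := by
    intro a
    simp [hsdef]
  have hsB : ∀ (mm : Fin j) (k : Fin 2), s (Fin.natAdd l (finProdFinEquiv (mm, k))) = e.symm (Sum.inl (k, mm)) := by
    intro mm k
    simp [hsdef]
  obtain ⟨ε, hε, hperm⟩ := foldl_cupList_ofFn_perm (Y := Y) (n := 2 * n') (l + j * 2) s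
  have hεsq : ε * ε = 1 := by rcases hε with rfl | rfl <;> norm_num
  -- assignments ↔ (free part, pair part)
  let W : (Fin l → ι) × (Fin (j * 2) → ι) ≃ (Fin (l + j * 2) → ι) :=
    ⟨fun φψ i ↦ Fin.append φψ.1 φψ.2 (s.symm i),
     fun w ↦ (fun a ↦ w (s (Fin.castAdd (j * 2) a)), fun t ↦ w (s (Fin.natAdd l t))),
     fun φψ ↦ by
       obtain ⟨φ, ψ⟩ := φψ
       refine Prod.ext (funext fun a ↦ ?_) (funext fun t ↦ ?_)
       · dsimp only
         rw [Equiv.symm_apply_apply, Fin.append_left]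
       · dsimp only
         rw [Equiv.symm_apply_apply, Fin.append_right],
     fun w ↦ funext fun i ↦ by
       obtain ⟨k, rfl⟩ : ∃ k, i = s k := ⟨s.symm i, (s.apply_symm_apply i).symm⟩
       dsimp only
       rw [Equiv.symm_apply_apply]
       induction k using Fin.addCases with
       | left a => rw [Fin.append_left]
       | right t => rw [Fin.append_right]⟩
  have hW1 : ∀ (φ : Fin l → ι) (ψ : Fin (j * 2) → ι) (a : Fin l), W (φ, ψ) (s (Fin.castAdd (j * 2) a)) = φ a := by
    intro φ ψ a
    simp [W, Fin.append_left]
  have hW2 : ∀ (φ : Fin l → ι) (ψ : Fin (j * 2) → ι) (t : Fin (j * 2)), W (φ, ψ) (s (Fin.natAdd l t)) = ψ t := by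
    intro φ ψ t
    simp [W, Fin.append_right]
  -- the chain of `w` as a fold over the list of its classes
  have hchain : ∀ w : Fin (l + j * 2) → ι,
      List.foldl (fun (acc : Σ i, bettiCohomology Y i) (y : bettiCohomology Y (2 * n')) =>
          ⟨acc.1 + 2 * n', cup Y acc.1 (2 * n') acc.2 y⟩) ⟨2 * q, wdec⟩
        (List.ofFn fun i ↦ pull (π (u i)) (2 * n') (bX (w i))) =
      List.foldl (fun (acc : Σ i, bettiCohomology Y i) (i : Fin (l + j * 2)) =>
          ⟨acc.1 + 2 * n', cup Y acc.1 (2 * n') acc.2 (pull (π (u i)) (2 * n') (bX (w i)))⟩) ⟨2 * q, wdec⟩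
        (List.finRange (l + j * 2)) := by
    intro w
    rw [List.ofFn_eq_map, List.foldl_map]
  -- degrees
  have hpd : 2 * p = 2 * q + 2 * n' * (l + j * 2) := by
    have h := congrArg Sigma.fst (hx w₀)
    rw [← hchain, foldl_cupList_fst, List.length_ofFn] at h
    exact h
  -- the sorted list of classes: the free classes, then the pair classes
  have hsorted : ∀ (φ : Fin l → ι) (ψ : Fin (j * 2) → ι),
      List.ofFn ((fun i ↦ pull (π (u i)) (2 * n') (bX (W (φ, ψ) i))) ∘ s) =
        List.ofFn (fun a ↦ pull (π (u (s (Fin.castAdd (j * 2) a)))) (2 * n') (bX (φ a))) ++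
          List.ofFn (fun t ↦ pull (π (u (s (Fin.natAdd l t)))) (2 * n') (bX (ψ t))) := by
    intro φ ψ
    rw [← List.ofFn_fin_append]
    congr 1
    funext i
    induction i using Fin.addCases with
    | left a => rw [Fin.append_left, Function.comp_apply, hW1]
    | right t => rw [Fin.append_right, Function.comp_apply, hW2]
  -- the sorted chain of `W (φ, ψ)`, with its sign
  have hxs : ∀ (ψ : Fin (j * 2) → ι) (φ : Fin l → ι),
      (⟨2 * p, ε • x (W (φ, ψ))⟩ : Σ i, bettiCohomology Y i) =
      List.foldl (fun (acc : Σ i, bettiCohomology Y i) (y : bettiCohomology Y (2 * n')) =>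
          ⟨acc.1 + 2 * n', cup Y acc.1 (2 * n') acc.2 y⟩) ⟨2 * q, wdec⟩
        (List.ofFn (fun a ↦ (fun a i ↦ pull (π (u (s (Fin.castAdd (j * 2) a)))) (2 * n') (bX i)) a (φ a)) ++
          List.ofFn (fun t ↦ pull (π (u (s (Fin.natAdd l t)))) (2 * n') (bX (ψ t)))) := by
    intro ψ φ
    rw [sigma_mk_smul_eq_of_eq _ _ (hx (W (φ, ψ))) ε, ← hchain, ← hperm, hsorted]
  -- absorbing the free slots: the contracted chains `x'' ψ`
  set x'' : (Fin (j * 2) → ι) → bettiCohomology Y (2 * p) := fun ψ ↦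
    ∑ φ : Fin l → ι, (∏ a, c a (φ a)) • (ε • x (W (φ, ψ))) with hx''
  have hx''chain : ∀ ψ : Fin (j * 2) → ι, (⟨2 * p, x'' ψ⟩ : Σ i, bettiCohomology Y i) =
      List.foldl (fun (acc : Σ i, bettiCohomology Y i) (y : bettiCohomology Y (2 * n')) =>
          ⟨acc.1 + 2 * n', cup Y acc.1 (2 * n') acc.2 y⟩) ⟨2 * q, wdec⟩
        (List.ofFn (fun a ↦ ∑ i, c a i • pull (π (u (s (Fin.castAdd (j * 2) a)))) (2 * n') (bX i)) ++
          List.ofFn (fun t ↦ pull (π (u (s (Fin.natAdd l t)))) (2 * n') (bX (ψ t)))) := fun ψ ↦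
    foldl_cupList_sum_prod_smul_prefix _ l ⟨2 * q, wdec⟩
      (fun a i ↦ pull (π (u (s (Fin.castAdd (j * 2) a)))) (2 * n') (bX i)) c (fun φ ↦ ε • x (W (φ, ψ)))
      (by rw [List.length_ofFn, hpd]; ring) (hxs ψ)
  -- the free classes `z a = Σ c a i • b i`, pulled back
  have hz : (fun a : Fin l ↦ ∑ i, c a i • pull (π (u (s (Fin.castAdd (j * 2) a)))) (2 * n') (bX i)) =
      fun a ↦ pull (π (u (s (Fin.castAdd (j * 2) a)))) (2 * n') (∑ i, c a i • bX i) := by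
    funext a
    rw [map_sum]
    simp only [map_smul]
  obtain ⟨wdec', hwdec', hfold⟩ := exists_wdec_foldl_pull hP hX hY n' l
    (fun a ↦ π (u (s (Fin.castAdd (j * 2) a)))) (fun a ↦ ∑ i, c a i • bX i) hc q wdec hwdec (q + n' * l) rfl
  -- `x''` is a chain from the algebraic decoration `wdec'` over the pair slots
  have hx''2 : ∀ ψ : Fin (j * 2) → ι, (⟨2 * p, x'' ψ⟩ : Σ i, bettiCohomology Y i) =
      List.foldl (fun (acc : Σ i, bettiCohomology Y i) (i : Fin (j * 2)) =>
          ⟨acc.1 + 2 * n', cup Y acc.1 (2 * n') acc.2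
            (pull (π ((fun t ↦ u (s (Fin.natAdd l t))) i)) (2 * n') (bX (ψ i)))⟩)
        ⟨2 * (q + n' * l), wdec'⟩ (List.finRange (j * 2)) := by
    intro ψ
    rw [hx''chain, List.foldl_append, hz, hfold, List.ofFn_eq_map, List.foldl_map]
  -- the perfect-pairing brick on the pair slots
  have h6 := ofRatClass_sum_smul_cupChain_mem_algebraicClasses hP hY h2 bX π
    (fun t ↦ u (s (Fin.natAdd l t))) (q + n' * l) wdec' hwdec' p x'' hx''2
    (finProdFinEquiv.symm.trans (Equiv.prodComm (Fin j) (Fin 2))) Θ hΘ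
  have he6 : ∀ (mm : Fin j) (k : Fin 2),
      (finProdFinEquiv.symm.trans (Equiv.prodComm (Fin j) (Fin 2))).symm (k, mm) = finProdFinEquiv (mm, k) := by
    intro mm k
    rfl
  simp only [he6] at h6
  -- comparison of the two sums
  have hcoefA : ∀ (φ : Fin l → ι) (ψ : Fin (j * 2) → ι) (mm : Fin j) (k : Fin 2),
      W (φ, ψ) (e.symm (Sum.inl (k, mm))) = ψ (finProdFinEquiv (mm, k)) := by
    intro φ ψ mm k
    rw [← hsB, hW2]
  have hcoefB : ∀ (φ : Fin l → ι) (ψ : Fin (j * 2) → ι) (a : Fin l), W (φ, ψ) (e.symm (Sum.inr a)) = φ a := by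
    intro φ ψ a
    rw [← hsA, hW1]
  have hsum : ∑ w : Fin (l + j * 2) → ι,
      ((∏ mm, Θ mm (w (e.symm (Sum.inl (0, mm)))) (w (e.symm (Sum.inl (1, mm))))) *
          ∏ a, c a (w (e.symm (Sum.inr a)))) • x w =
      ε • ∑ ψ : Fin (j * 2) → ι,
        (∏ mm, Θ mm (ψ (finProdFinEquiv (mm, 0))) (ψ (finProdFinEquiv (mm, 1)))) • x'' ψ := by
    rw [← W.sum_comp, Fintype.sum_prod_type, Finset.sum_comm, Finset.smul_sum]
    refine Finset.sum_congr rfl fun ψ _ ↦ ?_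
    rw [hx'', Finset.smul_sum, Finset.smul_sum]
    refine Finset.sum_congr rfl fun φ _ ↦ ?_
    simp only [hcoefA, hcoefB, smul_smul]
    congr 1
    calc (∏ mm, Θ mm (ψ (finProdFinEquiv (mm, 0))) (ψ (finProdFinEquiv (mm, 1)))) * ∏ a, c a (φ a)
        = (ε * ε) * ((∏ mm, Θ mm (ψ (finProdFinEquiv (mm, 0))) (ψ (finProdFinEquiv (mm, 1)))) *
            ∏ a, c a (φ a)) := by rw [hεsq, one_mul]
      _ = ε * ((∏ mm, Θ mm (ψ (finProdFinEquiv (mm, 0))) (ψ (finProdFinEquiv (mm, 1)))) *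
            ((∏ a, c a (φ a)) * ε)) := by ring
  rw [hsum, Literature.AlgebraicGeometry.Motives.ofRatClass_smul]
  exact Submodule.smul_mem _ _ h6

end Summit.HodgeConjecture.HodgeConjecture.Theorems.CyclicUnitaryPowersCupChainFreeSlots

end
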